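import Mathlib
import Summits.Ventures.PercRepro2.ThreeMarkOne

/-!
# The doubling form: `S(μ₀ + 2μ₁) ≥ S(μ₀ + μ₁)` — the candidate at the critical pair weight `c = 3`
(blind cell PercRepro2, night-3 g23, 2026-08-28; `proofs/NIGHT3-CERT.md` §32.8, §32.12)

Along the killing family `μ₀ + xμ₁` (`μ₁` = the `v ∈ C_s` part of the cluster law) the BHK slack is
the quadratic `S(x) = S(μ₀) + x·M + x²·S(μ₁)`; (PS) is `S′(0) ≥ 0`, (PS1) is `S′(1) ≥ 0`, and the
family `M + c·S(μ₁) ≥ 0` has a critical weight `c*`: `c = 4` (`S′(2) ≥ 0`) is FALSE (exact witness,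
§32.8) while `c = 3`, i.e. **`S(2) ≥ S(1)`: doubling the weight of the `v`-containing clusters does
not decrease the BHK slack**, survives every exact test (random census, adversarial weight climbs,
and the TYPED count `(3M) + 3·S₁` on all 1,362,083 abstract instances with ≤ 6 mixed edges, where
`(3M) + 4·S₁` already fails on 11 of them).  In the weight language `S(2) = S_{1 + 1_{vH}}`.

* `PointSplitDouble` (CANDIDATE, NOT claimed proved): `S_{1 + 1_{v ∈ C_s}} ≥ S_1` for all `p, X, Y, v`
  and nonnegative monotone `F, G`;
* `double_sub_eq`: `S_{1 + 1_{vH}} − S_1 = M(1_{vH}, 1) + S_{1_{vH}}` (polarisation), so the candidate is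
  `M(1_{vH}, 1_{v̄H}) + 3·S_{1_{vH}} ≥ 0` (`double_sub_eq'`);
* `pointSplitBHKOne_of_pointSplitBHK_of_double`: (PS) ∧ (doubling) ⟹ (PS1), by
  `M + 2S₁ = (M + 3S₁)·(2/3) + M·(1/3)`;
* `ThreeMarkThree` (CANDIDATE): the doubling form on the (3M) data,
  `m(011)m(100) + m(111)m(000) + 3m(100)m(111) ≤ m(101)m(010) + m(001)m(110) + 3m(110)m(101)`, with
  `threeMarkThree_of_pointSplitDouble`.
Own work; standard axioms.
-/

namespace Summit.Ventures.PercRepro2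

open UnionCluster

namespace CovForm

namespace PointSplit

open RootEdge

variable {V : Type*} {E : Type*} [Fintype E] [DecidableEq E]
  {R : Type*} [Field R] [LinearOrder R] [IsStrictOrderedRing R]

/-- **The doubling candidate (NOT claimed proved)**: `S_{1 + 1_{v ∈ C_s}}(F, G) ≥ S_1(F, G)` — the
BHK slack does not decrease when the `v`-containing clusters are counted twice. -/
def PointSplitDouble [DecidableEq V] (ends : E → Sym2 V) (s : V) : Prop :=
  ∀ (p : E → R), IsProbVec p → ∀ (X Y : Finset V) (v : V) (F G : Set V → R),
    Monotone F → Monotone G → (∀ S, 0 ≤ F S) → (∀ S, 0 ≤ G S) →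
      bhkFormW p ends s X Y F G (fun _ => 1) ≤
        bhkFormW p ends s X Y F G ((fun _ => 1) + (connEvent ends s v).indicator 1)

omit [LinearOrder R] [IsStrictOrderedRing R] in
/-- `S_{1 + 1_{vH}} − S_1 = M(1_{vH}, 1) + S_{1_{vH}}`. -/
lemma double_sub_eq [DecidableEq V] (p : E → R) (ends : E → Sym2 V) (s v : V) (X Y : Finset V)
    (F G : Set V → R) :
    bhkFormW p ends s X Y F G ((fun _ => 1) + (connEvent ends s v).indicator 1) -
        bhkFormW p ends s X Y F G (fun _ => 1) =
      mixedFormW p ends s X Y F G ((connEvent ends s v).indicator 1) (fun _ => 1) +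
        bhkFormW p ends s X Y F G ((connEvent ends s v).indicator 1) := by
  rw [bhkFormW_add, mixedFormW_comm]
  ring

omit [LinearOrder R] [IsStrictOrderedRing R] in
/-- `S_{1 + 1_{vH}} − S_1 = M(1_{vH}, 1_{v̄H}) + 3·S_{1_{vH}}`: the candidate is the pair weight
`XOR + 3·AND`. -/
lemma double_sub_eq' [DecidableEq V] (p : E → R) (ends : E → Sym2 V) (s v : V) (X Y : Finset V)
    (F G : Set V → R) :
    bhkFormW p ends s X Y F G ((fun _ => 1) + (connEvent ends s v).indicator 1) -
        bhkFormW p ends s X Y F G (fun _ => 1) =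
      mixedFormW p ends s X Y F G ((connEvent ends s v).indicator 1)
          (((connEvent ends s v)ᶜ).indicator 1) +
        3 * bhkFormW p ends s X Y F G ((connEvent ends s v).indicator 1) := by
  rw [double_sub_eq, mixedForm_one_eq]
  ring

/-- **(PS) ∧ (doubling) ⟹ (PS1)** at the source `s`: `M + 2S₁ = (2/3)(M + 3S₁) + (1/3)M`. -/
theorem pointSplitBHKOne_of_pointSplitBHK_of_double [DecidableEq V] (ends : E → Sym2 V) (s : V)
    (hPS : PointSplitBHK (R := R) ends s) (hD : PointSplitDouble (R := R) ends s) :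
    PointSplitBHKOne (R := R) ends s := by
  intro p hp X Y v F G hF hG hF0 hG0
  have h1 := hPS p hp X Y v F G hF hG hF0 hG0
  have h2 := hD p hp X Y v F G hF hG hF0 hG0
  have h3 := double_sub_eq' p ends s v X Y F G
  rw [mixedForm_one_eq]
  -- `M + 3S₁ ≥ 0` from `h2`, `h3`; `M ≥ 0` from `h1`
  have h4 : 0 ≤ mixedFormW p ends s X Y F G ((connEvent ends s v).indicator 1)
      (((connEvent ends s v)ᶜ).indicator 1) +
      3 * bhkFormW p ends s X Y F G ((connEvent ends s v).indicator 1) := by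
    rw [← h3]; linarith [h2]
  linarith [h1, h4]

/-- **(3M3), a CANDIDATE (NOT claimed proved)**: the doubling form on the (3M) data,
`m(011)m(100) + m(111)m(000) + 3m(100)m(111) ≤ m(101)m(010) + m(001)m(110) + 3m(110)m(101)` for
every product law.  Typed census (night-3 g23): 0 negative on all 1,362,083 abstract instances with
≤ 6 mixed edges, while the `c = 4` form is typed-negative on 11 of them. -/
def ThreeMarkThree [DecidableEq V] (ends : E → Sym2 V) (a₁ a₂ b o v : V) : Prop :=
  ∀ (p : E → R), IsProbVec p →
    cell p ends a₁ a₂ b o v false true true * cell p ends a₁ a₂ b o v true false false +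
        cell p ends a₁ a₂ b o v true true true * cell p ends a₁ a₂ b o v false false false +
        3 * (cell p ends a₁ a₂ b o v true false false * cell p ends a₁ a₂ b o v true true true) ≤
      cell p ends a₁ a₂ b o v true false true * cell p ends a₁ a₂ b o v false true false +
        cell p ends a₁ a₂ b o v false false true * cell p ends a₁ a₂ b o v true true false +
        3 * (cell p ends a₁ a₂ b o v true true false * cell p ends a₁ a₂ b o v true false true)

omit [LinearOrder R] [IsStrictOrderedRing R] in
/-- The class-`v` BHK slack of `(h, o)` in the cells: `S_{1_{vH}} = m(110)m(101) − m(100)m(111)`. -/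
lemma classSlack_eq_cells [Fintype V] [DecidableEq V] (p : E → R) (ends : E → Sym2 V)
    (a₁ a₂ b o v : V) :
    bhkFormW p ends a₂ {a₁} {a₁} (fun W => 1 - delClusterProb p ends a₁ {U | b ∈ U} W)
        ({W | o ∈ W}.indicator 1) ((connEvent ends a₂ v).indicator 1) =
      cell p ends a₁ a₂ b o v true true false * cell p ends a₁ a₂ b o v true false true -
        cell p ends a₁ a₂ b o v true false false * cell p ends a₁ a₂ b o v true true true := by
  have ha : a₁ ∈ ({a₁} : Finset V) := Finset.mem_singleton_self a₁
  rw [connEvent_eq_clusterInEvent]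
  unfold bhkFormW
  simp only [Finset.inter_self, Finset.union_self]
  rw [wExpect_one_sub_del_indicator p ends a₂ a₁ ha, wExpect_one_indicator,
    wExpect_one_sub_del p ends a₂ a₁ ha, wExpect_indicator_indicator,
    massPS_ov p ends a₁ a₂ b o v, massPS_ov_b p ends a₁ a₂ b o v, massPS_v p ends a₁ a₂ b o v,
    massPS_v_b p ends a₁ a₂ b o v]
  ring

/-- **(doubling) ⟹ (3M3)**: the doubling candidate at the source `a₂` implies `ThreeMarkThree`. -/
theorem threeMarkThree_of_pointSplitDouble [Fintype V] [DecidableEq V] (ends : E → Sym2 V)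
    (a₁ a₂ b o v : V) (h : PointSplitDouble (R := R) ends a₂) :
    ThreeMarkThree (R := R) ends a₁ a₂ b o v := by
  intro p hp
  have hg := delClusterProb_anti p hp ends a₁ (isUpperSet_mem_setOf b)
  have hF : Monotone (fun W => 1 - delClusterProb p ends a₁ {U | b ∈ U} W) := by
    intro W W' hWW'
    simp only
    linarith [hg hWW']
  have hF0 : ∀ S, 0 ≤ (fun W => 1 - delClusterProb p ends a₁ {U | b ∈ U} W) S := by
    intro S
    simp only
    linarith [delClusterProb_le_one p hp ends a₁ {U | b ∈ U} S]
  have hG : Monotone ({W : Set V | o ∈ W}.indicator (1 : Set V → R)) :=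
    monotone_indicator_one_of_isUpperSet (isUpperSet_mem_setOf o)
  have hG0 : ∀ S, 0 ≤ {W : Set V | o ∈ W}.indicator (1 : Set V → R) S :=
    fun S => Set.indicator_apply_nonneg fun _ => zero_le_one
  have key := h p hp {a₁} {a₁} v _ _ hF hG hF0 hG0
  have e := double_sub_eq' p ends a₂ v {a₁} {a₁}
    (fun W => 1 - delClusterProb p ends a₁ {U | b ∈ U} W) ({W | o ∈ W}.indicator 1)
  rw [threeMark_slack_eq_mixedForm, classSlack_eq_cells] at e
  linarith [key, e]

end PointSplit

end CovForm

end Summit.Ventures.PercRepro2
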